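import Summits.AtomisticToContinuum.FouriersLaw.Theses.BondHeatUncertainty
import Literature.MathematicalPhysics.KineticTheory.InfiniteChainDynamics
import Literature.MathematicalPhysics.KineticTheory.InfiniteChainInvariantStates

/-!
# Line `helfand-window-box-gk` — crux `BondHeatUncertainty.SubdiffusiveBondHeat` (stmt-AtomisticToContinuum-9120)

Skeleton (crux-plan, round 1) of crux idea card `helfand-window-box-gk` (ideator k = 1; triage r1-1: pass,
with two sharpenings, both acted on below).

THE LINE. Fix parameters `ω₂, lam, β, γ > 0`, `T > 0`, `P = pinnedChain ω₂ lam β γ`, the `N`-site open chain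
with both Langevin baths at temperature `T`, the constructed kernels `P.transitionKernel N T T s` and the Gibbs
state `μ_T = P.gibbsMeasure N T` (exactly the objects of the crux). For an observable `f` write
`C_f(s) = ∫ f · (κ_s f) dμ_T` (`eqCorr`), `V_f(t) = 2∫₀ᵗ (t-s) C_f(s) ds` (`heatVar`; for `f = j_b` this IS the
crux's `V N b t`) and `R_f(ν) = ∫₀^∞ e^{-νs} C_f(s) ds` (`laplaceCorr`, the resolvent quadratic form
`⟨f, (ν - L_N)⁻¹ f⟩_{μ_T}` written at kernel level).

* HELFAND RAMP (known device: Rost–Vares 1985 / Jara–Landim 2006 smoothing of the current through a bond; closed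
  summit card single-bond-ledger (L0)–(L1)). For a bond `b` and a window `W = {b+1, …, b+ℓ}` with `b+ℓ+1 < N`
  (no bath acts on `W`), the ramp `φ_x = 1 - (x-b-1)/ℓ` and the symmetrically split site energies `ẽ_x` give
  `L_N Z_φ = j_b - J_W/ℓ` EXACTLY (`Z_φ = Σ_W φ_x ẽ_x`, `J_W = Σ_{x∈W} j_x`, from `L_H ẽ_x = j_{x-1} - j_x`
  and `∂_{p_0} Z_φ = ∂_{p_{N-1}} Z_φ = 0`), hence pathwise `∫₀ᵗ j_b = ΔZ_φ + ℓ⁻¹ ∫₀ᵗ J_W` and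
  `V_{j_b}(t) ≤ 8 Var_{μ_T}(Z_φ) + 2ℓ⁻² V_{J_W}(t)` — STUB 1 (`stub_rampWindow`), with the statics
  `Var_{μ_T}(Z_φ) ≤ Cst·ℓ` — STUB 2 (`stub_windowStatics`).
* LAPLACE DOMINATION. `s ↦ C_{J_W}(|s|)` is of positive type (covariance of the stationary Markov process), so
  `V_{J_W}(t) ≤ 20·t·R_{J_W}(1/t)` (spectral side: `t² sinc²(ωt/2) ≤ 5t²/(1+ω²t²)`; or the
  Kipnis–Varadhan / Komorowski–Landim–Olla resolvent-martingale bound, constant `(3+√2)² < 20`) — STUB 3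
  (`stub_laplaceDomination`). So the crux needs ONE resolvent bound per scale on the DIFFUSIVE DIAGONAL:
  `R_{J_{W_ℓ}}(ν) ≤ B·ℓ` for `1 ≤ ℓ²ν ≤ 4`, `1/(cN²) ≤ ν ≤ 1` (window `ℓ = ⌈√t⌉`, frequency `ν = 1/t`).
* BAND SPLIT (triage sharpening (2)). HIGH band `N·ν ≥ C₀ log N`: the resolvent at frequency `ν` only probes
  times `≲ ν⁻¹ log(1/ε)`, during which a bulk window (`b = N/4`) does not hear the baths (thermal Lieb–Robinson
  bounds), so the bound is the Edwards–Wilkinson law of the INFINITE equilibrium chain in Laplace form — STUB 4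
  (`stub_infiniteChainLaplaceEW`, stated over `InfiniteChainDynamics` + DLR Gibbs states) transported by STUB 5
  (`stub_lightConeTransfer : InfiniteChainLaplaceEW → HighBandResolvent`). TOP band
  `1/(cN²) ≤ ν ≤ C₀ log N / N` (the `½ log₂ N` top dyadic scales, up to the Thouless frequency): a
  scale-by-scale family of open-chain AC-conductance bounds, whose top member is the regularised total-current
  Green–Kubo bound `⟨J_tot,(ν-L_N)⁻¹J_tot⟩ ≤ B″N` at `ν ≍ 1/(cN²)` — STUB 6 (`stub_topBandAC`, the HARDEST:
  it is a bounded-AC-conductance statement, i.e. it meets `Literature.Barriers.AtomisticToContinuum.HasBoundedResponse`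
  head-on, as the card and the triage both record).
* COMPOSITION (`SubdiffusiveBondHeat_of`, sorry-free real arithmetic): `b = N/4`, `ℓ = ⌈√t⌉ ∈ [√t, 2√t]`,
  `ν = 1/t`, `c' = min c (1/16)` (so that `N/4 + ℓ + 1 < N`), `A = 16·max(Cst,0) + 40·max(B₁,B₂,0)`:
  `V ≤ 8Cst·ℓ + 2ℓ⁻²·20t·Bℓ ≤ 16Cst√t + 40B√t`.

HONEST LABEL (triage sharpening (1)). On the diagonal there is NO second-vs-first-moment gap: reading the ramp
identity backwards, STUBS 4–6 together are EQUIVALENT to the crux at the bulk bond modulo STUBS 1–3. The value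
of the line is the decomposition: the bulk-bond crux becomes one resolvent bound per dyadic scale, additive over
windows, positive in frequency, open to variational (test-corrector) upper bounds, with the infinite-chain part
(high band) separated from the conductance band (top) at POSITIVE FREQUENCY, where light-cone bounds suffice
rigorously — unlike the route's time-domain plan (OpenVsInfinite → BathWindow up to `t ≍ N²`).

Disproof.lean: none exists for this crux (2026-08-15); nothing to honour or avoid. Negatives index: the only
FouriersLaw entry (`DiluteCellGaussianiser.FarFieldGaussianity`) is unrelated; no stub is an instance of it.

Namespace `…Cruxes.SubdiffusiveBondHeat.HelfandWindowBoxGk`. The six stub STATEMENTS are the `def`s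
`RampWindow`, `WindowStatics`, `LaplaceDomination`, `InfiniteChainLaplaceEW`, `LightConeTransfer`, `TopBandAC`;
each is followed by its REGISTERED `theorem stub_… : <Statement> := by sorry`; `Registered.stub_…` are the
name-keyed aliases used as hypotheses of `SubdiffusiveBondHeat_of` (device of
`Cruxes/LagHandOff/Lines/crosscut-dictionary.lean`), which concludes the crux BY NAME.
-/

noncomputable section

open MeasureTheory Set Filter Topology
open scoped BigOperators NNReal

namespace Summit.AtomisticToContinuum.FouriersLaw.Cruxes.SubdiffusiveBondHeat.HelfandWindowBoxGk

open Literature.MathematicalPhysics.KineticTheory.HeatConduction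
open Summit.AtomisticToContinuum.FouriersLaw.Theses.BondHeatUncertainty (SubdiffusiveBondHeat)

/-! ## Kernel-level objects of the open chain (transparent abbreviations of the crux's own objects) -/

/-- Equilibrium autocorrelation `C_f(s) = ∫ f(z) · (κ_s f)(z) dμ_T(z)` of an observable `f` of the `N`-site
chain with both baths at `T` (constructed kernels, Gibbs state) — for `f = j_b` literally the crux's `C N b s`. -/
def eqCorr (P : OscillatorChain) (N : ℕ) (T : ℝ) (f : PhaseSpace N → ℝ) (s : ℝ) : ℝ :=
  ∫ z, f z * (∫ y, f y ∂(P.transitionKernel N T T s.toNNReal z)) ∂(P.gibbsMeasure N T)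

/-- `V_f(t) = 2 ∫₀ᵗ (t - s) C_f(s) ds` — the equilibrium variance of `∫₀ᵗ f(z_s) ds` written at kernel level;
for `f = j_b` literally the crux's `V N b t`. -/
def heatVar (P : OscillatorChain) (N : ℕ) (T : ℝ) (f : PhaseSpace N → ℝ) (t : ℝ) : ℝ :=
  2 * ∫ s in (0 : ℝ)..t, (t - s) * eqCorr P N T f s

/-- `R_f(ν) = ∫₀^∞ e^{-νs} C_f(s) ds` — the resolvent quadratic form `⟨f, (ν - L_N)⁻¹ f⟩_{μ_T}` at kernel
level (Laplace transform of the autocorrelation). -/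
def laplaceCorr (P : OscillatorChain) (N : ℕ) (T : ℝ) (f : PhaseSpace N → ℝ) (ν : ℝ) : ℝ :=
  ∫ s in Ioi (0 : ℝ), Real.exp (-(ν * s)) * eqCorr P N T f s

/-- `Var_{μ_T}(f)`. -/
def gibbsVar (P : OscillatorChain) (N : ℕ) (T : ℝ) (f : PhaseSpace N → ℝ) : ℝ :=
  ∫ z, (f z - ∫ y, f y ∂(P.gibbsMeasure N T)) ^ 2 ∂(P.gibbsMeasure N T)

/-- The window current `J_W = Σ_{b < i ≤ b+ℓ} j_i` (currents of the bonds `(i, i+1)`, `i ∈ W = {b+1,…,b+ℓ}`;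
truncated at the right end if the window sticks out). -/
def windowCurrent (P : OscillatorChain) (N b ℓ : ℕ) (z : PhaseSpace N) : ℝ :=
  ∑ i : Fin N, if b < i.val ∧ i.val ≤ b + ℓ then P.bondCurrent N i z else 0

/-- The symmetrically split site energy `ẽ_x = p_x²/2 + U(q_x) + ½V(q_x - q_{x-1}) + ½V(q_{x+1} - q_x)`
(missing bonds omitted at the ends); `Σ_x ẽ_x = H` and `L_H ẽ_x = j_{x-1} - j_x`. -/
def symSiteEnergy (P : OscillatorChain) (N : ℕ) (x : Fin N) (z : PhaseSpace N) : ℝ :=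
  z.2 x ^ 2 / 2 + P.U (z.1 x) +
    ∑ j : Fin N, ((if x.val = j.val + 1 then P.V (z.1 x - z.1 j) / 2 else 0) +
      (if j.val = x.val + 1 then P.V (z.1 j - z.1 x) / 2 else 0))

/-- The Helfand ramp observable `Z_φ = Σ_{x ∈ W} φ_x ẽ_x`, `φ_x = 1 - (x - b - 1)/ℓ` on `W = {b+1,…,b+ℓ}`
(`φ_{b+1} = 1`, `φ_{b+ℓ} = 1/ℓ`, `0` outside), for which `L_N Z_φ = j_b - J_W/ℓ` when `b + ℓ + 1 < N`. -/
def rampEnergy (P : OscillatorChain) (N b ℓ : ℕ) (z : PhaseSpace N) : ℝ :=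
  ∑ x : Fin N, if b < x.val ∧ x.val ≤ b + ℓ then
    (1 - ((x.val : ℝ) - b - 1) / ℓ) * symSiteEnergy P N x z else 0

/-! ## The six stub STATEMENTS -/

/-- Statement of STUB 1 (`stub_rampWindow`, size M): the Helfand ramp inequality at kernel level. For every
bond `b` and window length `ℓ ≥ 1` with `b + ℓ + 1 < N` and every `t ≥ 0`:
`V_{j_b}(t) ≤ 8·Var_{μ_T}(Z_φ) + (2/ℓ²)·V_{J_W}(t)`.
Proof route: realise the stationary process `z_s = solMap s x (pairPath ω)` under `μ_T ⊗ wienerPair`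
(Gibbs invariance of the constructed kernels — Echeverría / Itô, shared with BoundaryEscapeDeficit's
`BoundaryKernelBasics` (a) — and Chapman–Kolmogorov `pinnedChain_transitionKernel_add` give
`Var(∫₀ᵗ f(z_s)ds) = V_f(t)` for `f ∈ {j_b, J_W}`, both `μ_T`-centred by momentum reversal); the sites of `W`
carry no bath, so `t ↦ Z_φ(z_t)` is `C¹` with derivative `(L_H Z_φ)(z_t) = j_b(z_t) - J_W(z_t)/ℓ` (telescoping
`L_H ẽ_x = j_{x-1} - j_x` against the ramp); then `(a+b)² ≤ 2a² + 2b²` twice and stationarity. -/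
def RampWindow : Prop :=
  ∀ ω₂ lam β γ : ℝ, 0 < ω₂ → 0 < lam → 0 < β → 0 < γ → ∀ T : ℝ, 0 < T →
    ∀ (N b ℓ : ℕ) (hb : b < N), b + ℓ + 1 < N → 1 ≤ ℓ → ∀ t : ℝ, 0 ≤ t →
      heatVar (pinnedChain ω₂ lam β γ) N T ((pinnedChain ω₂ lam β γ).bondCurrent N ⟨b, hb⟩) t ≤
        8 * gibbsVar (pinnedChain ω₂ lam β γ) N T (rampEnergy (pinnedChain ω₂ lam β γ) N b ℓ) +
          2 / (ℓ : ℝ) ^ 2 *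
            heatVar (pinnedChain ω₂ lam β γ) N T (windowCurrent (pinnedChain ω₂ lam β γ) N b ℓ) t

/-- Statement of STUB 2 (`stub_windowStatics`, size M): the static cost of the ramp is linear in the window,
uniformly in `N` and in the position `b`: `Var_{μ_T}(Z_φ) ≤ Cst·ℓ` (`0 ≤ φ ≤ 1`, and the one-dimensional
nearest-neighbour Gibbs state `μ_T ∝ e^{-H/T}` has summable covariances `Cov(ẽ_x, ẽ_y)`, uniformly in `N`:
transfer operator with the confining pinning `ω₂q²/2 + lam q⁴/4`; moments from
`pinnedChain_integrable_exp_mul_gibbsDensity`). -/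
def WindowStatics : Prop :=
  ∀ ω₂ lam β γ : ℝ, 0 < ω₂ → 0 < lam → 0 < β → 0 < γ → ∀ T : ℝ, 0 < T →
    ∃ Cst : ℝ, ∀ N b ℓ : ℕ, b + ℓ + 1 < N → 1 ≤ ℓ →
      gibbsVar (pinnedChain ω₂ lam β γ) N T (rampEnergy (pinnedChain ω₂ lam β γ) N b ℓ) ≤ Cst * ℓ

/-- Statement of STUB 3 (`stub_laplaceDomination`, size M): domination of the finite-time variance by the
resolvent form at the conjugate frequency, `V_{J_W}(t) ≤ 20·t·R_{J_W}(1/t)` for `t > 0`. Two proofs: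
(i) `s ↦ C_{J_W}(|s|)` is continuous, bounded and of positive type (it is the covariance function of the
stationary Markov process of STUB 1), so by Bochner `V(t) = ∫ t² sinc²(ωt/2) dσ(ω)` and
`t·R(1/t) = ∫ t²/(1+ω²t²) dσ(ω)`, and `sinc²(x/2) ≤ 5/(1+x²)`; (ii) Komorowski–Landim–Olla 2012 Ch. 2:
with `u = (t⁻¹ - L)⁻¹J_W`, `∫₀ᵗ J_W = t⁻¹∫₀ᵗ u - Δu + M_t`, `‖·‖₂ ≤ (3 + √2)√t·R(1/t)^{1/2}`, and
`(3+√2)² < 20`. Integrability of `s ↦ e^{-s/t} C(s)` on `(0,∞)` (bounded, measurable by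
`pinnedChain_measurable_transitionKernel`) is part of the claim, so `laplaceCorr` is never Bochner junk here. -/
def LaplaceDomination : Prop :=
  ∀ ω₂ lam β γ : ℝ, 0 < ω₂ → 0 < lam → 0 < β → 0 < γ → ∀ T : ℝ, 0 < T →
    ∀ (N b ℓ : ℕ) (t : ℝ), 0 < t →
      heatVar (pinnedChain ω₂ lam β γ) N T (windowCurrent (pinnedChain ω₂ lam β γ) N b ℓ) t ≤
        20 * t * laplaceCorr (pinnedChain ω₂ lam β γ) N T (windowCurrent (pinnedChain ω₂ lam β γ) N b ℓ) t⁻¹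

/-- Statement of STUB 4 (`stub_infiniteChainLaplaceEW`, size XL): the Edwards–Wilkinson law of the INFINITE
equilibrium chain in Laplace form, on the diffusive diagonal. For every infinite-volume dynamics `D` of
`P = pinnedChain ω₂ lam β γ` (`InfiniteChainDynamics`: carrier + flow solving (1a)–(1b), e.g. Buttà–Marchioro
2016 Thm 2.1 on `𝒳₀`) and every translation-invariant DLR Gibbs state `μ` at temperature `T` preserved by `D`:
there is `B` with `∫₀^∞ e^{-νs} ⟨J_ℓ, J_ℓ ∘ φ_s⟩_μ ds ≤ B·ℓ` for all `ℓ ≥ 1` and all frequencies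
`0 < ν ≤ 1` with `1 ≤ ℓ²ν ≤ 4`, where `J_ℓ = Σ_{x=1}^{ℓ} j_x` (`bondCurrentZ`). Fluctuating hydrodynamics
predicts `R_ℓ(ν) = (σ/2)∫ (dk/2π) 4sin²(kℓ/2)/k² · ν/(ν + D²k⁴/…) ≍ κT²·ℓ` on the diagonal; nothing of the
kind is proved for a deterministic anharmonic chain (BLR2000 §6.3) — this is the infinite-volume half of the
crux's content (kinetic theory's habitat: Aoki–Lukkarinen–Spohn 2006, Lukkarinen–Spohn). Calibration: false
for `lam = β = 0` (ballistic phonons: `R_ℓ(ℓ⁻²) ≍ ℓ²`), as the crux is. -/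
def InfiniteChainLaplaceEW : Prop :=
  ∀ ω₂ lam β γ : ℝ, 0 < ω₂ → 0 < lam → 0 < β → 0 < γ → ∀ T : ℝ, 0 < T →
    ∀ (D : InfiniteChainDynamics (pinnedChain ω₂ lam β γ)) (μ : Measure ChainConfig),
      (pinnedChain ω₂ lam β γ).IsChainGibbsMeasure T μ → D.PreservesMeasure μ → IsShiftInvariant μ →
      ∃ B : ℝ, ∀ ℓ : ℕ, 1 ≤ ℓ → ∀ ν : ℝ, 0 < ν → ν ≤ 1 → 1 ≤ (ℓ : ℝ) ^ 2 * ν → (ℓ : ℝ) ^ 2 * ν ≤ 4 →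
        ∫ s in Ioi (0 : ℝ), Real.exp (-(ν * s)) *
          (∫ σ, (∑ x ∈ Finset.range ℓ, (pinnedChain ω₂ lam β γ).bondCurrentZ σ ((x : ℤ) + 1)) *
              (∑ x ∈ Finset.range ℓ, (pinnedChain ω₂ lam β γ).bondCurrentZ (D.flow s σ) ((x : ℤ) + 1)) ∂μ) ≤
          B * ℓ

/-- The HIGH-BAND resolvent bound for the open chain (conclusion of STUB 5): for frequencies above the echo
frequency, `C₀ log N ≤ N·ν` (`ν ≤ 1`), on the diagonal `1 ≤ ℓ²ν ≤ 4`, the window at the bulk bond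
`b = N/4` satisfies `R_{J_W}(ν) ≤ B·ℓ`, uniformly in `N ≥ N₁`. -/
def HighBandResolvent : Prop :=
  ∀ ω₂ lam β γ : ℝ, 0 < ω₂ → 0 < lam → 0 < β → 0 < γ → ∀ T : ℝ, 0 < T →
    ∃ B C₀ : ℝ, 0 < C₀ ∧ ∃ N₁ : ℕ, ∀ N : ℕ, N₁ ≤ N → ∀ (ℓ : ℕ) (ν : ℝ),
      C₀ * Real.log N ≤ (N : ℝ) * ν → ν ≤ 1 → 1 ≤ (ℓ : ℝ) ^ 2 * ν → (ℓ : ℝ) ^ 2 * ν ≤ 4 →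
      N / 4 + ℓ + 1 < N →
        laplaceCorr (pinnedChain ω₂ lam β γ) N T
          (windowCurrent (pinnedChain ω₂ lam β γ) N (N / 4) ℓ) ν ≤ B * ℓ

/-- Statement of STUB 5 (`stub_lightConeTransfer`, size L): positive-frequency light-cone transfer — the
infinite-chain Laplace EW law implies the open-chain high-band bound. Content: (a) an infinite equilibrium
dynamics `(D, μ)` of the pinned chain exists (Buttà–Marchioro 2016 Thm 2.1 = tree fact
`ButtaMarchioro2016_thm21_chain`, invariance of tempered Gibbs states); (b) for `N·ν ≥ C₀ log N` the weight
`e^{-νs}` cuts the Laplace integral at times `S = ν⁻¹ log(N^k) ≤ N/(8v)` up to an error `‖J_W‖²e^{-νS}/ν ≤ ℓ`,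
and up to time `S` the window at `b = N/4` (distance `≥ N/4 - 1` from both baths) evolves under the open
stochastic chain as under the infinite deterministic one up to super-exponentially small leakage (thermal
Lieb–Robinson / finite-speed bounds, Buttà et al. 2007 Thm 2.2, Buttà–Marchioro 2016 Thm 2.2, in an `L²`
form for polynomial observables), while the bulk marginals of `μ_T^N` and `μ` near `W` agree up to `e^{-cN}`
(one-dimensional decorrelation). This is the step the time-domain plan cannot make beyond `t ≍ N/v`. -/
def LightConeTransfer : Prop :=
  InfiniteChainLaplaceEW → HighBandResolvent

/-- Statement of STUB 6 (`stub_topBandAC`, size XL, the HARDEST): the TOP-BAND family of open-chain AC bounds.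
For every `C₀ > 0` there are `B`, `c > 0`, `N₂` such that for `N ≥ N₂`, every frequency
`1/(cN²) ≤ ν ≤ C₀ log N / N` and every window `ℓ` on the diagonal `1 ≤ ℓ²ν ≤ 4` fitting in the bulk
(`N/4 + ℓ + 1 < N`): `R_{J_W}(ν) ≤ B·ℓ` at `b = N/4`. These are the `≈ ½ log₂ N` top dyadic scales
`(N/(C₀ log N))^{1/2} ≲ ℓ ≲ √c·N`; windows are comparable only at comparable scales
(`J_{W_ℓ}/ℓ = J_{W_L}/L + L_H Z` costs `νχL ≤ √ν` only for `L ≲ ℓ/χ`), so this is a genuine scale-by-scale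
family, whose top member (`ℓ ≍ √c N`, `ν ≍ 1/(cN²)`, via the tent corrector `j_b + L_H u_tent = J_tot/(N-1)`)
is the regularised total-current Green–Kubo bound `⟨J_tot, (ν - L_N)⁻¹ J_tot⟩_{μ_T} ≤ B″N` — a bounded
AC-conductance statement of `HasBoundedResponse` strength (barrier met head-on, not evaded). No rate, gap or
`t → ∞` limit enters (frequencies `≥ 1/(cN²)` only: `BeckerMenegaki2022_gapClosing` does not bite). -/
def TopBandAC : Prop :=
  ∀ ω₂ lam β γ : ℝ, 0 < ω₂ → 0 < lam → 0 < β → 0 < γ → ∀ T : ℝ, 0 < T →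
    ∀ C₀ : ℝ, 0 < C₀ → ∃ B c : ℝ, 0 < c ∧ ∃ N₂ : ℕ, ∀ N : ℕ, N₂ ≤ N → ∀ (ℓ : ℕ) (ν : ℝ),
      1 / (c * (N : ℝ) ^ 2) ≤ ν → (N : ℝ) * ν ≤ C₀ * Real.log N → 1 ≤ (ℓ : ℝ) ^ 2 * ν →
      (ℓ : ℝ) ^ 2 * ν ≤ 4 → N / 4 + ℓ + 1 < N →
        laplaceCorr (pinnedChain ω₂ lam β γ) N T
          (windowCurrent (pinnedChain ω₂ lam β γ) N (N / 4) ℓ) ν ≤ B * ℓ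

/-! ## Registered stubs -/

/-- STUB 1 (M): the Helfand ramp inequality at kernel level (statement `RampWindow`). -/
theorem stub_rampWindow : RampWindow := by
  sorry

/-- STUB 2 (M): static cost of the ramp, `Var_{μ_T}(Z_φ) ≤ Cst·ℓ` (statement `WindowStatics`). -/
theorem stub_windowStatics : WindowStatics := by
  sorry

/-- STUB 3 (M): Laplace domination `V_{J_W}(t) ≤ 20 t R_{J_W}(1/t)` (statement `LaplaceDomination`). -/
theorem stub_laplaceDomination : LaplaceDomination := by
  sorry

/-- STUB 4 (XL): Edwards–Wilkinson law of the infinite equilibrium chain in Laplace form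
(statement `InfiniteChainLaplaceEW`). -/
theorem stub_infiniteChainLaplaceEW : InfiniteChainLaplaceEW := by
  sorry

/-- STUB 5 (L): positive-frequency light-cone transfer (statement `LightConeTransfer`). -/
theorem stub_lightConeTransfer : LightConeTransfer := by
  sorry

/-- STUB 6 (XL, HARDEST): the top-band family of open-chain AC bounds (statement `TopBandAC`). -/
theorem stub_topBandAC : TopBandAC := by
  sorry

/-! ## Name-keyed aliases of the six statements (the hypotheses of the composition)

`Registered.stub_X` is statement `X` under the registered stub's short name, so that the native skeleton audit
(`#h21_check_skeleton`: hypotheses admissible iff registered obligations / declared stubs BY NAME) accepts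
`SubdiffusiveBondHeat_of : Registered.stub_rampWindow → … → SubdiffusiveBondHeat` (same device as
`Cruxes/LagHandOff/Lines/crosscut-dictionary.lean`, `Cruxes/SubcylindricalRecognition/Lines/entropy-ratchet.lean`). -/
namespace Registered

/-- Alias of `RampWindow` keyed by the registered stub name. -/
abbrev stub_rampWindow : Prop := RampWindow
/-- Alias of `WindowStatics` keyed by the registered stub name. -/
abbrev stub_windowStatics : Prop := WindowStatics
/-- Alias of `LaplaceDomination` keyed by the registered stub name. -/
abbrev stub_laplaceDomination : Prop := LaplaceDomination
/-- Alias of `InfiniteChainLaplaceEW` keyed by the registered stub name. -/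
abbrev stub_infiniteChainLaplaceEW : Prop := InfiniteChainLaplaceEW
/-- Alias of `LightConeTransfer` keyed by the registered stub name. -/
abbrev stub_lightConeTransfer : Prop := LightConeTransfer
/-- Alias of `TopBandAC` keyed by the registered stub name. -/
abbrev stub_topBandAC : Prop := TopBandAC

end Registered

/-! ## Consistency: each statement IS its registered stub (definitional) -/

theorem rampWindow_holds : RampWindow := stub_rampWindow
theorem windowStatics_holds : WindowStatics := stub_windowStatics
theorem laplaceDomination_holds : LaplaceDomination := stub_laplaceDomination
theorem infiniteChainLaplaceEW_holds : InfiniteChainLaplaceEW := stub_infiniteChainLaplaceEW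
theorem lightConeTransfer_holds : LightConeTransfer := stub_lightConeTransfer
theorem topBandAC_holds : TopBandAC := stub_topBandAC
theorem highBandResolvent_holds : HighBandResolvent := stub_lightConeTransfer stub_infiniteChainLaplaceEW

/-! ## Composition (sorry-free) -/

/-- **The skeleton concludes the crux BY NAME.** `SubdiffusiveBondHeat` (route `BondHeatUncertainty`,
stmt-AtomisticToContinuum-9120) from the six registered stubs: window `ℓ = ⌈√t⌉`, frequency `ν = 1/t`,
bulk bond `b = N/4`, `c' = min c (1/16)`, `A = 16·max(Cst,0) + 40·max(B₁,B₂,0)`. -/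
theorem subdiffusive_core (h₁ : RampWindow) (h₂ : WindowStatics) (h₃ : LaplaceDomination)
    (hH : HighBandResolvent) (h₆ : TopBandAC) {ω₂ lam β γ : ℝ} (hω : 0 < ω₂) (hl : 0 < lam)
    (hβ : 0 < β) (hγ : 0 < γ) {T : ℝ} (hT : 0 < T) :
    ∃ A c : ℝ, 0 < c ∧ ∃ N₀ : ℕ, ∀ N : ℕ, N₀ ≤ N → ∃ (b : ℕ) (hb : b < N), b + 1 < N ∧
      ∀ t : ℝ, 1 ≤ t → t ≤ c * (N : ℝ) ^ 2 →
        heatVar (pinnedChain ω₂ lam β γ) N T ((pinnedChain ω₂ lam β γ).bondCurrent N ⟨b, hb⟩) t ≤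
          A * Real.sqrt t := by
  obtain ⟨Cst, hCst⟩ := h₂ ω₂ lam β γ hω hl hβ hγ T hT
  obtain ⟨B₁, C₀, hC₀, N₁, hHigh⟩ := hH ω₂ lam β γ hω hl hβ hγ T hT
  obtain ⟨B₂, c, hc, N₂, hTop⟩ := h₆ ω₂ lam β γ hω hl hβ hγ T hT C₀ hC₀
  set P := pinnedChain ω₂ lam β γ with hPdef
  -- the constants
  set B : ℝ := max (max B₁ B₂) 0 with hBdef
  have hB0 : 0 ≤ B := le_max_right _ _
  have hB1 : B₁ ≤ B := (le_max_left _ _).trans (le_max_left _ _)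
  have hB2 : B₂ ≤ B := (le_max_right _ _).trans (le_max_left _ _)
  set Cs : ℝ := max Cst 0 with hCsdef
  have hCs0 : 0 ≤ Cs := le_max_right _ _
  have hCs1 : Cst ≤ Cs := le_max_left _ _
  refine ⟨16 * Cs + 40 * B, min c (1 / 16), lt_min hc (by norm_num), max (max N₁ N₂) 8, ?_⟩
  intro N hN
  have hN₁ : N₁ ≤ N := le_trans ((le_max_left _ _).trans (le_max_left _ _)) hN
  have hN₂ : N₂ ≤ N := le_trans ((le_max_right _ _).trans (le_max_left _ _)) hN
  have hN8 : 8 ≤ N := le_trans (le_max_right _ _) hN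
  have hbN : N / 4 < N := Nat.div_lt_self (by omega) (by norm_num)
  refine ⟨N / 4, hbN, by omega, ?_⟩
  intro t ht1 htc
  -- elementary real facts
  have ht0 : 0 < t := by linarith
  have hNr : (8 : ℝ) ≤ N := by exact_mod_cast hN8
  have hN2 : (0 : ℝ) ≤ (N : ℝ) ^ 2 := by positivity
  have htN : t ≤ (N : ℝ) ^ 2 / 16 := by
    have : min c (1 / 16) * (N : ℝ) ^ 2 ≤ (1 / 16) * (N : ℝ) ^ 2 :=
      mul_le_mul_of_nonneg_right (min_le_right _ _) hN2
    linarith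
  have htc' : t ≤ c * (N : ℝ) ^ 2 := by
    have : min c (1 / 16) * (N : ℝ) ^ 2 ≤ c * (N : ℝ) ^ 2 :=
      mul_le_mul_of_nonneg_right (min_le_left _ _) hN2
    linarith
  -- the window ℓ = ⌈√t⌉ ∈ [√t, 2√t]
  set ℓ : ℕ := ⌈Real.sqrt t⌉₊ with hℓdef
  have hst1 : 1 ≤ Real.sqrt t := Real.one_le_sqrt.mpr ht1
  have hst0 : 0 < Real.sqrt t := by linarith
  have hsq : Real.sqrt t ^ 2 = t := Real.sq_sqrt ht0.le
  have hℓlo : Real.sqrt t ≤ (ℓ : ℝ) := Nat.le_ceil _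
  have hℓhi : (ℓ : ℝ) < Real.sqrt t + 1 := Nat.ceil_lt_add_one (Real.sqrt_nonneg _)
  have hℓ1r : (1 : ℝ) ≤ (ℓ : ℝ) := hst1.trans hℓlo
  have hℓ1 : 1 ≤ ℓ := by exact_mod_cast hℓ1r
  have hℓpos : (0 : ℝ) < ℓ := by linarith
  have hℓ2 : (ℓ : ℝ) ≤ 2 * Real.sqrt t := by linarith
  -- geometry: the window at the bulk bond b = N/4 fits, N/4 + ℓ + 1 < N
  have hgeom : N / 4 + ℓ + 1 < N := by
    have h4 : ((N / 4 : ℕ) : ℝ) ≤ (N : ℝ) / 4 := Nat.cast_div_le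
    have hsN : Real.sqrt t ≤ (N : ℝ) / 4 := by
      have h16 : t ≤ ((N : ℝ) / 4) ^ 2 := by nlinarith [htN]
      calc Real.sqrt t ≤ Real.sqrt (((N : ℝ) / 4) ^ 2) := Real.sqrt_le_sqrt h16
        _ = (N : ℝ) / 4 := Real.sqrt_sq (by positivity)
    have hreal : ((N / 4 : ℕ) : ℝ) + (ℓ : ℝ) + 1 < (N : ℝ) := by linarith
    exact_mod_cast hreal
  -- the conjugate frequency ν = t⁻¹ is on the diagonal of the window and in the Thouless range
  have hν1 : t⁻¹ ≤ 1 := inv_le_one_of_one_le₀ ht1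
  have hdiag1 : 1 ≤ (ℓ : ℝ) ^ 2 * t⁻¹ := by
    rw [← div_eq_mul_inv, le_div_iff₀ ht0, one_mul]
    nlinarith [hℓlo, hsq, hst0]
  have hdiag4 : (ℓ : ℝ) ^ 2 * t⁻¹ ≤ 4 := by
    rw [← div_eq_mul_inv, div_le_iff₀ ht0]
    nlinarith [hℓ2, hsq, hℓpos]
  have hlow : 1 / (c * (N : ℝ) ^ 2) ≤ t⁻¹ := by
    rw [one_div]
    exact inv_anti₀ ht0 htc'
  -- ONE resolvent bound on the diagonal, by band (high band from the infinite chain / top band)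
  have hR : laplaceCorr P N T (windowCurrent P N (N / 4) ℓ) t⁻¹ ≤ B * ℓ := by
    rcases le_total (C₀ * Real.log N) ((N : ℝ) * t⁻¹) with hband | hband
    · exact (hHigh N hN₁ ℓ t⁻¹ hband hν1 hdiag1 hdiag4 hgeom).trans
        (mul_le_mul_of_nonneg_right hB1 hℓpos.le)
    · exact (hTop N hN₂ ℓ t⁻¹ hlow hband hdiag1 hdiag4 hgeom).trans
        (mul_le_mul_of_nonneg_right hB2 hℓpos.le)
  -- Helfand ramp + statics + Laplace domination
  have hramp := h₁ ω₂ lam β γ hω hl hβ hγ T hT N (N / 4) ℓ hbN hgeom hℓ1 t ht0.le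
  have hstat : gibbsVar P N T (rampEnergy P N (N / 4) ℓ) ≤ Cs * ℓ :=
    (hCst N (N / 4) ℓ hgeom hℓ1).trans (mul_le_mul_of_nonneg_right hCs1 hℓpos.le)
  have hW : heatVar P N T (windowCurrent P N (N / 4) ℓ) t ≤ 20 * t * (B * ℓ) :=
    (h₃ ω₂ lam β γ hω hl hβ hγ T hT N (N / 4) ℓ t ht0).trans
      (mul_le_mul_of_nonneg_left hR (by positivity))
  have hW' : 2 / (ℓ : ℝ) ^ 2 * heatVar P N T (windowCurrent P N (N / 4) ℓ) t ≤
      2 / (ℓ : ℝ) ^ 2 * (20 * t * (B * ℓ)) :=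
    mul_le_mul_of_nonneg_left hW (by positivity)
  have htl : t / (ℓ : ℝ) ≤ Real.sqrt t := by
    rw [div_le_iff₀ hℓpos]
    nlinarith [mul_nonneg hst0.le (sub_nonneg.mpr hℓlo), hsq]
  calc heatVar P N T (P.bondCurrent N ⟨N / 4, hbN⟩) t
      ≤ 8 * gibbsVar P N T (rampEnergy P N (N / 4) ℓ) +
          2 / (ℓ : ℝ) ^ 2 * heatVar P N T (windowCurrent P N (N / 4) ℓ) t := hramp
    _ ≤ 8 * (Cs * ℓ) + 2 / (ℓ : ℝ) ^ 2 * (20 * t * (B * ℓ)) := by linarith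
    _ = 8 * Cs * ℓ + 40 * B * (t / ℓ) := by
      field_simp
      ring
    _ ≤ 8 * Cs * (2 * Real.sqrt t) + 40 * B * Real.sqrt t := by
      have h8 : 8 * Cs * (ℓ : ℝ) ≤ 8 * Cs * (2 * Real.sqrt t) :=
        mul_le_mul_of_nonneg_left hℓ2 (by positivity)
      have h40 : 40 * B * (t / ℓ) ≤ 40 * B * Real.sqrt t :=
        mul_le_mul_of_nonneg_left htl (by positivity)
      linarith
    _ = (16 * Cs + 40 * B) * Real.sqrt t := by ring

/-- **The skeleton concludes the crux BY NAME.** `SubdiffusiveBondHeat` (route `BondHeatUncertainty`,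
stmt-AtomisticToContinuum-9120) from the six registered stubs: window `ℓ = ⌈√t⌉`, frequency `ν = 1/t`,
bulk bond `b = N/4`, `c' = min c (1/16)`, `A = 16·max(Cst,0) + 40·max(B₁,B₂,0)`; the crux's `V N b t` is
`heatVar` of the bond current by `dif_pos (b < N)`. -/
theorem SubdiffusiveBondHeat_of (h₁ : Registered.stub_rampWindow) (h₂ : Registered.stub_windowStatics)
    (h₃ : Registered.stub_laplaceDomination) (h₄ : Registered.stub_infiniteChainLaplaceEW)
    (h₅ : Registered.stub_lightConeTransfer) (h₆ : Registered.stub_topBandAC) :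
    SubdiffusiveBondHeat := by
  intro ω₂ lam β γ hω hl hβ hγ T hT
  obtain ⟨A, c, hc, N₀, hmain⟩ := subdiffusive_core h₁ h₂ h₃ (h₅ h₄) h₆ hω hl hβ hγ hT
  dsimp only
  refine ⟨A, c, hc, N₀, fun N hN => ?_⟩
  obtain ⟨b, hb, hb1, hmt⟩ := hmain N hN
  refine ⟨b, hb1, fun t ht1 ht2 => ?_⟩
  simp only [dif_pos hb]
  exact hmt t ht1 ht2

end Summit.AtomisticToContinuum.FouriersLaw.Cruxes.SubdiffusiveBondHeat.HelfandWindowBoxGk
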